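import Mathlib
import Summits.Schanuel.Schanuel.Theorems.RigidCoreMinimalCounterexampleInAclHitSetZeroInBox
import Summits.Schanuel.Schanuel.Theorems.RigidCoreMinimalCounterexampleInAclHitSetExpEnclosure

/-!
# Ring-definable complex constants: isolated zeros, algebraic numbers, `2πi`, logarithms of algebraic numbers
# (crux stmt-Schanuel-0969 `RigidCore.MinimalCounterexampleInAcl`, line kernel-arithmetic-selection, stub S8‴)

`--supports stmt-Schanuel-0969`; foundation layer under `stub_corankOne_hitSetRingDefinable` (S8‴).  The constants of the
hit-pattern presentation — the coordinates `u_k` of the first failure (`e^{u_k} = α_k ∈ ℚ̄`), the period `2πi`, the algebraic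
numbers `α_k` — must be ARITHMETICAL complex numbers: their strict lower rational cuts (real and imaginary part) `∅`-definable in
the ring `ℤ` ("ring-definable" in the sense of `…HitSetBoxArith.lean`; the cut is written out in every statement).  This file:

* `ringDefinable_reCut_of_isolated_zero`, `defC_const_of_isolated_zero` — an ISOLATED ZERO `z₀` of a continuous `f : ℂ → ℂ` whose
  values at Gaussian rationals form a ring-definable family is a ring-definable constant: `p/r < re z₀` iff some rational
  sub-box of an isolating box, to the right of `p/r`, contains a zero of `f` (`ringDefinable_setOf_existsZeroInBox`);
* `defC_const_of_isAlgebraic` — algebraic numbers (isolated roots of rational polynomials);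
* `defC_const_twoPiI` — `2πi`, the isolated zero of `exp − 1` near `6.28 i` (so `π` IS AN ARITHMETICAL REAL, registered helper
  `ringDefinable_realCut_two_pi`);
* `defC_const_of_isAlgebraic_cexp` — every `u` with `e^u ∈ ℚ̄` (isolated zero of `exp − e^u`), using the ring-definability of
  `exp` on `ℚ[i]` (`defC_cexp_testPoint`, …HitSetExpEnclosure.lean).

References: K. Weihrauch, *Computable Analysis* (2000), §4.3, §6.3; H. Rogers (1967), §15.1 (arithmetical reals).
-/

-- the summit namespace `Summit.Schanuel.Schanuel.…` repeats a component by design (D-0022)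
set_option linter.dupNamespace false

open Set FirstOrder FirstOrder.Language Filter Topology

namespace Summit.Schanuel.Schanuel.Cruxes.MinimalCounterexampleInAcl.KernelArithmeticSelection

open Literature.ModelTheory.ExponentialFields

variable [FirstOrder.Ring.CompatibleRing ℤ] {σ : Type*}

/-! ## Isolated zeros are ring-definable constants -/

omit [FirstOrder.Ring.CompatibleRing ℤ] in
/-- A closed rational box of mesh `2/d` around `z₀` (with `z₀` in its interior) inside the `ε`-ball. -/
theorem exists_small_box (z₀ : ℂ) {ε : ℝ} (hε : 0 < ε) :
    ∃ a₁ a₂ c₁ c₂ d : ℤ, 0 < d ∧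
      ((a₁ : ℝ) / d < z₀.re ∧ z₀.re < (a₂ : ℝ) / d ∧ (c₁ : ℝ) / d < z₀.im ∧ z₀.im < (c₂ : ℝ) / d) ∧
      ∀ z : ℂ, ((a₁ : ℝ) / d ≤ z.re ∧ z.re ≤ (a₂ : ℝ) / d ∧ (c₁ : ℝ) / d ≤ z.im ∧ z.im ≤ (c₂ : ℝ) / d) →
        dist z z₀ < ε := by
  obtain ⟨n, hn⟩ := exists_nat_gt (4 / ε)
  set d : ℤ := (n : ℤ) + 1 with hd
  have hd0 : (0 : ℝ) < d := by rw [hd]; positivity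
  have hdε : 4 / (d : ℝ) < ε := by
    rw [div_lt_iff₀ hd0, hd]; push_cast; rw [div_lt_iff₀ hε] at hn; nlinarith
  have box : ∀ t : ℝ, ((⌊t * d⌋ - 1 : ℤ) : ℝ) / d < t ∧ t < ((⌊t * d⌋ + 1 : ℤ) : ℝ) / d ∧
      ∀ s : ℝ, ((⌊t * d⌋ - 1 : ℤ) : ℝ) / d ≤ s → s ≤ ((⌊t * d⌋ + 1 : ℤ) : ℝ) / d → |s - t| ≤ 2 / d := by
    intro t
    have h1 : ((⌊t * d⌋ - 1 : ℤ) : ℝ) / d < t := by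
      rw [div_lt_iff₀ hd0]; push_cast; linarith [Int.floor_le (t * d)]
    have h2 : t < ((⌊t * d⌋ + 1 : ℤ) : ℝ) / d := by
      rw [lt_div_iff₀ hd0]; push_cast; linarith [Int.lt_floor_add_one (t * d)]
    have e : ((⌊t * d⌋ + 1 : ℤ) : ℝ) / d = ((⌊t * d⌋ - 1 : ℤ) : ℝ) / d + 2 / d := by push_cast; ring
    refine ⟨h1, h2, fun s hs1 hs2 => ?_⟩
    rw [abs_sub_le_iff]; constructor <;> linarith
  obtain ⟨hr1, hr2, hr⟩ := box z₀.re
  obtain ⟨hi1, hi2, hi⟩ := box z₀.im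
  refine ⟨⌊z₀.re * d⌋ - 1, ⌊z₀.re * d⌋ + 1, ⌊z₀.im * d⌋ - 1, ⌊z₀.im * d⌋ + 1, d, by exact_mod_cast hd0,
    ⟨hr1, hr2, hi1, hi2⟩, fun z ⟨h1, h2, h3, h4⟩ => ?_⟩
  rw [Complex.dist_eq]
  calc ‖z - z₀‖ ≤ |(z - z₀).re| + |(z - z₀).im| := Complex.norm_le_abs_re_add_abs_im _
    _ ≤ 2 / d + 2 / d := by
        rw [Complex.sub_re, Complex.sub_im]; exact add_le_add (hr z.re h1 h2) (hi z.im h3 h4)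
    _ = 4 / d := by ring
    _ < ε := hdε

omit [FirstOrder.Ring.CompatibleRing ℤ] in
/-- A point of a finite set is isolated in it. -/
theorem exists_isolated_of_finite {Z : Set ℂ} (hZ : Z.Finite) (z₀ : ℂ) :
    ∃ ε > 0, ∀ z ∈ Z, dist z z₀ < ε → z = z₀ := by
  have hopen : IsOpen (Z \ {z₀})ᶜ := (hZ.subset fun z hz => hz.1).isClosed.isOpen_compl
  obtain ⟨ε, hε, hball⟩ := Metric.isOpen_iff.1 hopen z₀ (fun h => h.2 rfl)
  exact ⟨ε, hε, fun z hz hd => by_contra fun hne => hball (Metric.mem_ball.2 hd) ⟨hz, hne⟩⟩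

/-- **The real part of an isolated zero is a ring-definable constant.**  If `f : ℂ → ℂ` is continuous, its values at the
Gaussian rationals `(a + bi)/c` form a ring-definable complex family of `(a, b, c)`, and `z₀` is an isolated zero of `f`, then
`p/r < re z₀` iff some rational sub-box of an isolating box, lying to the right of `p/r`, contains a zero of `f` — a ring-definable
condition by `ringDefinable_setOf_existsZeroInBox`. [folklore] -/
theorem ringDefinable_reCut_of_isolated_zero {f : ℂ → ℂ} (hf : Continuous f)
    (hdef : ((∅ : Set ℤ).Definable Language.ring {w : _ ⊕ Fin 2 → ℤ | 0 < w (Sum.inr 1) ∧ ((w (Sum.inr 0) : ℤ) : ℝ) < ((w (Sum.inr 1) : ℤ) : ℝ) * ((Complex.re ∘ (fun t : Fin 3 → ℤ => f ((((t 0 : ℤ) : ℂ) + ((t 1 : ℤ) : ℂ) * Complex.I) / ((t 2 : ℤ) : ℂ)))) ∘ fun w' s => w' (Sum.inl s)) w} ∧ (∅ : Set ℤ).Definable Language.ring {w : _ ⊕ Fin 2 → ℤ | 0 < w (Sum.inr 1) ∧ ((w (Sum.inr 0) : ℤ) : ℝ) < ((w (Sum.inr 1) : ℤ) : ℝ) *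 ((Complex.im ∘ (fun t : Fin 3 → ℤ => f ((((t 0 : ℤ) : ℂ) + ((t 1 : ℤ) : ℂ) * Complex.I) / ((t 2 : ℤ) : ℂ)))) ∘ fun w' s => w' (Sum.inl s)) w}))
    {z₀ : ℂ} (hz₀ : f z₀ = 0) (hiso : ∃ ε > 0, ∀ z, f z = 0 → dist z z₀ < ε → z = z₀) :
    (∅ : Set ℤ).Definable Language.ring {w : _ ⊕ Fin 2 → ℤ | 0 < w (Sum.inr 1) ∧ ((w (Sum.inr 0) : ℤ) : ℝ) < ((w (Sum.inr 1) : ℤ) : ℝ) * ((fun _ : σ → ℤ => z₀.re) ∘ fun w' s => w' (Sum.inl s)) w} := by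
  obtain ⟨ε, hε, hiso⟩ := hiso
  obtain ⟨a₁, a₂, c₁, c₂, d, hd, ⟨hz1, hz2, hz3, hz4⟩, hbox⟩ := exists_small_box z₀ hε
  have hd' : (0 : ℝ) < d := by exact_mod_cast hd
  -- zeros of `f` in a variable box `b`, as a definable condition on `(w, b)`
  have hZ := ringDefinable_setOf_existsZeroInBox (σ := (σ ⊕ Fin 2) ⊕ Fin 5) (fun _ z => Complex.normSq (f z))
    (fun _ => Complex.continuous_normSq.comp hf) (fun _ z => Complex.normSq_nonneg _)
    (defR_normSq (defC_reindex hdef Sum.inr))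
    (definableFun_proj_params (Sum.inr 0)) (definableFun_proj_params (Sum.inr 1))
    (definableFun_proj_params (Sum.inr 2)) (definableFun_proj_params (Sum.inr 3)) (definableFun_proj_params (Sum.inr 4))
  have h : (∅ : Set ℤ).Definable Language.ring {w : σ ⊕ Fin 2 → ℤ | 0 < w (Sum.inr 1) ∧ ∃ b : Fin 5 → ℤ,
      (a₁ * b 4 ≤ b 0 * d ∧ b 1 * d ≤ a₂ * b 4 ∧ c₁ * b 4 ≤ b 2 * d ∧ b 3 * d ≤ c₂ * b 4) ∧
      w (Sum.inr 0) * b 4 < w (Sum.inr 1) * b 0 ∧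
      (Sum.elim w b) ∈ {u : (σ ⊕ Fin 2) ⊕ Fin 5 → ℤ | 0 < u (Sum.inr 4) ∧ ∃ z : ℂ,
        ((((u (Sum.inr 0)) : ℤ) : ℝ) / (((u (Sum.inr 4)) : ℤ) : ℝ) ≤ z.re ∧
          z.re ≤ (((u (Sum.inr 1)) : ℤ) : ℝ) / (((u (Sum.inr 4)) : ℤ) : ℝ) ∧
          (((u (Sum.inr 2)) : ℤ) : ℝ) / (((u (Sum.inr 4)) : ℤ) : ℝ) ≤ z.im ∧
          z.im ≤ (((u (Sum.inr 3)) : ℤ) : ℝ) / (((u (Sum.inr 4)) : ℤ) : ℝ)) ∧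
        (fun (_ : (σ ⊕ Fin 2) ⊕ Fin 5 → ℤ) (z : ℂ) => Complex.normSq (f z)) u z = 0}} := by
    refine definable_setOf_and_params (ringDefinable_setOf_lt ringDefinableFun_zero (definableFun_proj_params _))
      (definable_setOf_existsBlock (definable_setOf_and_params
        (definable_setOf_and_params
          (ringDefinable_setOf_le (ringDefinableFun_mul (ringDefinableFun_intCast a₁) (definableFun_proj_params _))
            (ringDefinableFun_mul (definableFun_proj_params _) (ringDefinableFun_intCast d)))
        (definable_setOf_and_params
          (ringDefinable_setOf_le (ringDefinableFun_mul (definableFun_proj_params _) (ringDefinableFun_intCast d))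
            (ringDefinableFun_mul (ringDefinableFun_intCast a₂) (definableFun_proj_params _)))
        (definable_setOf_and_params
          (ringDefinable_setOf_le (ringDefinableFun_mul (ringDefinableFun_intCast c₁) (definableFun_proj_params _))
            (ringDefinableFun_mul (definableFun_proj_params _) (ringDefinableFun_intCast d)))
          (ringDefinable_setOf_le (ringDefinableFun_mul (definableFun_proj_params _) (ringDefinableFun_intCast d))
            (ringDefinableFun_mul (ringDefinableFun_intCast c₂) (definableFun_proj_params _))))))
        (definable_setOf_and_params
          (ringDefinable_setOf_lt (ringDefinableFun_mul (definableFun_proj_params _) (definableFun_proj_params _))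
            (ringDefinableFun_mul (definableFun_proj_params _) (definableFun_proj_params _)))
          ?_)))
    exact hZ
  convert h using 1
  ext w
  simp only [mem_setOf_eq, Function.comp_apply, Sum.elim_inr, Complex.normSq_eq_zero]
  refine and_congr_right fun hr => ?_
  set p := w (Sum.inr 0)
  set r := w (Sum.inr 1)
  have hr' : (0 : ℝ) < r := by exact_mod_cast hr
  constructor
  · intro hlt
    rw [← int_div_lt_iff hr] at hlt
    obtain ⟨P, R, hR, hs1, hs2⟩ := exists_int_div_btwn (max_lt hlt hz1)
    have hR' : (0 : ℝ) < R := by exact_mod_cast hR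
    have hpr : (p : ℝ) / r < P / R := (le_max_left _ _).trans_lt hs1
    have ha : (a₁ : ℝ) / d < P / R := (le_max_right _ _).trans_lt hs1
    rw [div_lt_div_iff₀ hr' hR'] at hpr
    rw [div_lt_div_iff₀ hd' hR'] at ha
    refine ⟨![P * d, a₂ * R, c₁ * R, c₂ * R, R * d], ⟨?_, ?_, ?_, ?_⟩, ?_, ?_, z₀, ⟨?_, ?_, ?_, ?_⟩, hz₀⟩
    all_goals simp only [Matrix.cons_val_zero, Matrix.cons_val_one, Matrix.cons_val]
    · have : (a₁ : ℝ) * (R * d) ≤ P * d * d := by nlinarith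
      exact_mod_cast this
    · exact le_of_eq (by ring)
    · exact le_of_eq (by ring)
    · exact le_of_eq (by ring)
    · have : (p : ℝ) * (R * d) < r * (P * d) := by nlinarith
      exact_mod_cast this
    · exact mul_pos hR hd
    · push_cast; rw [mul_div_mul_right _ _ hd'.ne']; exact hs2.le
    · push_cast; rw [mul_comm (R : ℝ) (d : ℝ), mul_div_mul_right _ _ hR'.ne']; exact hz2.le
    · push_cast; rw [mul_comm (R : ℝ) (d : ℝ), mul_div_mul_right _ _ hR'.ne']; exact hz3.le
    · push_cast; rw [mul_comm (R : ℝ) (d : ℝ), mul_div_mul_right _ _ hR'.ne']; exact hz4.le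
  · rintro ⟨b, ⟨h1, h2, h3, h4⟩, hpb, hb4, z, ⟨hz1', hz2', hz3', hz4'⟩, hfz⟩
    have hb4' : (0 : ℝ) < b 4 := by exact_mod_cast hb4
    have h1' : (a₁ : ℝ) * b 4 ≤ b 0 * d := by exact_mod_cast h1
    have h2' : (b 1 : ℝ) * d ≤ a₂ * b 4 := by exact_mod_cast h2
    have h3' : (c₁ : ℝ) * b 4 ≤ b 2 * d := by exact_mod_cast h3
    have h4' : (b 3 : ℝ) * d ≤ c₂ * b 4 := by exact_mod_cast h4
    have hzz : z = z₀ := hiso z hfz (hbox z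
      ⟨((div_le_div_iff₀ hd' hb4').2 (by linarith)).trans hz1', hz2'.trans ((div_le_div_iff₀ hb4' hd').2 (by linarith)),
       ((div_le_div_iff₀ hd' hb4').2 (by linarith)).trans hz3', hz4'.trans ((div_le_div_iff₀ hb4' hd').2 (by linarith))⟩)
    subst hzz
    rw [← int_div_lt_iff hr]
    have hpb' : (p : ℝ) * b 4 < r * b 0 := by exact_mod_cast hpb
    have : (p : ℝ) / r < b 0 / b 4 := by rw [div_lt_div_iff₀ hr' hb4']; linarith
    exact this.trans_le hz1'

/-- The imaginary part of an isolated zero is a ring-definable constant (the real part of the isolated zero `-i z₀` of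
`z ↦ f (i z)`). [folklore] -/
theorem ringDefinable_imCut_of_isolated_zero {f : ℂ → ℂ} (hf : Continuous f)
    (hdef : ((∅ : Set ℤ).Definable Language.ring {w : _ ⊕ Fin 2 → ℤ | 0 < w (Sum.inr 1) ∧ ((w (Sum.inr 0) : ℤ) : ℝ) < ((w (Sum.inr 1) : ℤ) : ℝ) * ((Complex.re ∘ (fun t : Fin 3 → ℤ => f ((((t 0 : ℤ) : ℂ) + ((t 1 : ℤ) : ℂ) * Complex.I) / ((t 2 : ℤ) : ℂ)))) ∘ fun w' s => w' (Sum.inl s)) w} ∧ (∅ : Set ℤ).Definable Language.ring {w : _ ⊕ Fin 2 → ℤ | 0 < w (Sum.inr 1) ∧ ((w (Sum.inr 0) : ℤ) : ℝ) < ((w (Sum.inr 1) : ℤ) : ℝ) * ((Complex.im ∘ (fun t : Fin 3 → ℤ => f ((((t 0 : ℤ) : ℂ) + ((t 1 : ℤ) : ℂ) * Complex.I) / ((t 2 : ℤ) : ℂ)))) ∘ fun w' s => w' (Sum.inl s)) w}))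
    {z₀ : ℂ} (hz₀ : f z₀ = 0) (hiso : ∃ ε > 0, ∀ z, f z = 0 → dist z z₀ < ε → z = z₀) :
    (∅ : Set ℤ).Definable Language.ring {w : _ ⊕ Fin 2 → ℤ | 0 < w (Sum.inr 1) ∧ ((w (Sum.inr 0) : ℤ) : ℝ) < ((w (Sum.inr 1) : ℤ) : ℝ) * ((fun _ : σ → ℤ => z₀.im) ∘ fun w' s => w' (Sum.inl s)) w} := by
  obtain ⟨ε, hε, hiso⟩ := hiso
  have hII : ∀ z : ℂ, Complex.I * (-Complex.I * z) = z := fun z => by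
    rw [← mul_assoc, mul_neg, Complex.I_mul_I, neg_neg, one_mul]
  have hII' : ∀ z : ℂ, -Complex.I * (Complex.I * z) = z := fun z => by
    rw [← mul_assoc, neg_mul, Complex.I_mul_I, neg_neg, one_mul]
  have hrot : ∀ z : ℂ, Complex.I * z - z₀ = Complex.I * (z - (-Complex.I * z₀)) := fun z => by
    rw [mul_sub, hII]
  have hF : (∅ : Set ℤ).DefinableMap Language.ring (fun t : Fin 3 → ℤ => (![-t 1, t 0, t 2] : Fin 3 → ℤ)) := by
    intro i
    fin_cases i
    · simpa using ringDefinableFun_neg (definableFun_proj_params (L := Language.ring) (A := (∅ : Set ℤ)) (1 : Fin 3))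
    · simpa using definableFun_proj_params (L := Language.ring) (A := (∅ : Set ℤ)) (0 : Fin 3)
    · simpa using definableFun_proj_params (L := Language.ring) (A := (∅ : Set ℤ)) (2 : Fin 3)
  have e : ∀ a b c : ℂ, (-b + a * Complex.I) / c = Complex.I * ((a + b * Complex.I) / c) := by
    intro a b c
    rw [← mul_div_assoc]
    congr 1
    linear_combination (-b) * Complex.I_mul_I
  have hdef' : ((∅ : Set ℤ).Definable Language.ring {w : _ ⊕ Fin 2 → ℤ | 0 < w (Sum.inr 1) ∧ ((w (Sum.inr 0) : ℤ) : ℝ) < ((w (Sum.inr 1) : ℤ) : ℝ) * ((Complex.re ∘ (fun t : Fin 3 → ℤ => (fun z => f (Complex.I * z))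
      ((((t 0 : ℤ) : ℂ) + ((t 1 : ℤ) : ℂ) * Complex.I) / ((t 2 : ℤ) : ℂ)))) ∘ fun w' s => w' (Sum.inl s)) w} ∧ (∅ : Set ℤ).Definable Language.ring {w : _ ⊕ Fin 2 → ℤ | 0 < w (Sum.inr 1) ∧ ((w (Sum.inr 0) : ℤ) : ℝ) < ((w (Sum.inr 1) : ℤ) : ℝ) * ((Complex.im ∘ (fun t : Fin 3 → ℤ => (fun z => f (Complex.I * z))
      ((((t 0 : ℤ) : ℂ) + ((t 1 : ℤ) : ℂ) * Complex.I) / ((t 2 : ℤ) : ℂ)))) ∘ fun w' s => w' (Sum.inl s)) w}) := by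
    refine defC_congr (defC_substitute hdef hF) fun t => ?_
    simp only [Matrix.cons_val_zero, Matrix.cons_val_one, Matrix.cons_val, Int.cast_neg]
    rw [e]
  have h := ringDefinable_reCut_of_isolated_zero (σ := σ) (f := fun z => f (Complex.I * z))
    (hf.comp (continuous_const.mul continuous_id)) hdef' (z₀ := -Complex.I * z₀)
    (by show f (Complex.I * (-Complex.I * z₀)) = 0; rw [hII]; exact hz₀)
    ⟨ε, hε, fun z hz hdz => by
      have hdist : dist (Complex.I * z) z₀ < ε := by
        rw [Complex.dist_eq, hrot, norm_mul, Complex.norm_I, one_mul, ← Complex.dist_eq]; exact hdz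
      have := hiso _ hz hdist
      rw [← this, hII']⟩
  exact defR_congr h fun v => by simp

/-- **An isolated zero of a continuous function with ring-definable values on `ℚ[i]` is a ring-definable complex constant.**
[folklore] -/
theorem defC_const_of_isolated_zero {f : ℂ → ℂ} (hf : Continuous f)
    (hdef : ((∅ : Set ℤ).Definable Language.ring {w : _ ⊕ Fin 2 → ℤ | 0 < w (Sum.inr 1) ∧ ((w (Sum.inr 0) : ℤ) : ℝ) < ((w (Sum.inr 1) : ℤ) : ℝ) * ((Complex.re ∘ (fun t : Fin 3 → ℤ => f ((((t 0 : ℤ) : ℂ) + ((t 1 : ℤ) : ℂ) * Complex.I) / ((t 2 : ℤ) : ℂ)))) ∘ fun w' s => w' (Sum.inl s)) w} ∧ (∅ : Set ℤ).Definable Language.ring {w : _ ⊕ Fin 2 → ℤ | 0 < w (Sum.inr 1) ∧ ((w (Sum.inr 0) : ℤ) : ℝ) < ((w (Sum.inr 1) : ℤ) : ℝ) * ((Complex.im ∘ (fun t : Fin 3 → ℤ => f ((((t 0 : ℤ) : ℂ) + ((t 1 : ℤ) : ℂ) * Complex.I) / ((t 2 : ℤ) : ℂ)))) ∘ fun w'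 s => w' (Sum.inl s)) w}))
    {z₀ : ℂ} (hz₀ : f z₀ = 0) (hiso : ∃ ε > 0, ∀ z, f z = 0 → dist z z₀ < ε → z = z₀) :
    ((∅ : Set ℤ).Definable Language.ring {w : _ ⊕ Fin 2 → ℤ | 0 < w (Sum.inr 1) ∧ ((w (Sum.inr 0) : ℤ) : ℝ) < ((w (Sum.inr 1) : ℤ) : ℝ) * ((Complex.re ∘ (fun _ : σ → ℤ => z₀)) ∘ fun w' s => w' (Sum.inl s)) w} ∧ (∅ : Set ℤ).Definable Language.ring {w : _ ⊕ Fin 2 → ℤ | 0 < w (Sum.inr 1) ∧ ((w (Sum.inr 0) : ℤ) : ℝ) < ((w (Sum.inr 1) : ℤ) : ℝ) * ((Complex.im ∘ (fun _ : σ → ℤ => z₀)) ∘ fun w' s => w' (Sum.inl s)) w}) :=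
  ⟨defR_congr (ringDefinable_reCut_of_isolated_zero hf hdef hz₀ hiso) fun v => by simp,
    defR_congr (ringDefinable_imCut_of_isolated_zero hf hdef hz₀ hiso) fun v => by simp⟩

/-- **Every algebraic number is a ring-definable complex constant** (an isolated root of a non-zero rational polynomial, whose
values at Gaussian rationals are ring-definable by `defC_polynomial_aeval`). [folklore] -/
theorem defC_const_of_isAlgebraic {α : ℂ} (hα : IsAlgebraic ℚ α) : ((∅ : Set ℤ).Definable Language.ring {w : _ ⊕ Fin 2 → ℤ | 0 < w (Sum.inr 1) ∧ ((w (Sum.inr 0) : ℤ) : ℝ) < ((w (Sum.inr 1) : ℤ) : ℝ) * ((Complex.re ∘ (fun _ : σ → ℤ => α)) ∘ fun w' s => w' (Sum.inl s)) w} ∧ (∅ : Set ℤ).Definable Language.ring {w : _ ⊕ Fin 2 → ℤ | 0 < w (Sum.inr 1) ∧ ((w (Sum.inr 0) : ℤ) : ℝ) < ((w (Sum.inr 1) : ℤ) : ℝ) * ((Complex.im ∘ (fun _ : σ → ℤ => α)) ∘ fun w' s => w' (Sum.inl s)) w}) := by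
  obtain ⟨P, hP0, hPα⟩ := hα
  have hfin : Set.Finite {z : ℂ | Polynomial.aeval z P = 0} := by
    have hne : Polynomial.map (algebraMap ℚ ℂ) P ≠ 0 :=
      (Polynomial.map_ne_zero_iff (algebraMap ℚ ℂ).injective).2 hP0
    refine (Polynomial.finite_setOf_isRoot hne).subset fun z hz => ?_
    simp only [mem_setOf_eq] at hz ⊢
    rw [Polynomial.IsRoot.def, Polynomial.eval_map, ← Polynomial.aeval_def]; exact hz
  obtain ⟨ε, hε, hiso⟩ := exists_isolated_of_finite hfin α
  exact defC_const_of_isolated_zero (Polynomial.continuous_aeval P)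
    (defC_polynomial_aeval P (defC_testPoint (definableFun_proj_params _) (definableFun_proj_params _)
      (definableFun_proj_params _))) hPα ⟨ε, hε, fun z hz hd => hiso z hz hd⟩

/-! ## `2πi` and logarithms of algebraic numbers -/

omit [FirstOrder.Ring.CompatibleRing ℤ] in
/-- Integer multiples of `2πi` other than `0` have norm `≥ 2π > 1`. -/
theorem one_le_norm_int_mul_two_pi_I {n : ℤ} (hn : n ≠ 0) : (1 : ℝ) < ‖(n : ℂ) * (2 * ↑Real.pi * Complex.I)‖ := by
  rw [norm_mul, Complex.norm_intCast, norm_mul, Complex.norm_I, mul_one, norm_mul, Complex.norm_real, Real.norm_eq_abs,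
    abs_of_pos Real.pi_pos, Complex.norm_two]
  have h1 : (1 : ℝ) ≤ |(n : ℝ)| := by
    rw [← Int.cast_abs]; exact_mod_cast Int.one_le_abs hn
  nlinarith [Real.pi_gt_three, abs_nonneg (n : ℝ)]

/-- **`2πi` is a ring-definable complex constant** (the isolated zero of `exp − 1` at distance `< 1` from itself only).
[folklore] -/
theorem defC_const_twoPiI : ((∅ : Set ℤ).Definable Language.ring {w : _ ⊕ Fin 2 → ℤ | 0 < w (Sum.inr 1) ∧ ((w (Sum.inr 0) : ℤ) : ℝ) < ((w (Sum.inr 1) : ℤ) : ℝ) * ((Complex.re ∘ (fun _ : σ → ℤ => 2 * (Real.pi : ℂ) * Complex.I)) ∘ fun w' s => w' (Sum.inl s)) w} ∧ (∅ : Set ℤ).Definable Language.ring {w : _ ⊕ Fin 2 → ℤ | 0 < w (Sum.inr 1) ∧ ((w (Sum.inr 0) : ℤ) : ℝ) < ((w (Sum.inr 1) : ℤ) : ℝ) * ((Complex.im ∘ (fun _ : σ → ℤ => 2 * (Real.pi : ℂ) * Complex.I)) ∘ fun w' s => w' (Sum.inl s)) w}) := by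
  have hdef : ((∅ : Set ℤ).Definable Language.ring {w : _ ⊕ Fin 2 → ℤ | 0 < w (Sum.inr 1) ∧ ((w (Sum.inr 0) : ℤ) : ℝ) < ((w (Sum.inr 1) : ℤ) : ℝ) * ((Complex.re ∘ (fun t : Fin 3 → ℤ =>
      Complex.exp ((((t 0 : ℤ) : ℂ) + ((t 1 : ℤ) : ℂ) * Complex.I) / ((t 2 : ℤ) : ℂ)) - 1)) ∘ fun w' s => w' (Sum.inl s)) w} ∧ (∅ : Set ℤ).Definable Language.ring {w : _ ⊕ Fin 2 → ℤ | 0 < w (Sum.inr 1) ∧ ((w (Sum.inr 0) : ℤ) : ℝ) < ((w (Sum.inr 1) : ℤ) : ℝ) * ((Complex.im ∘ (fun t : Fin 3 → ℤ =>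
      Complex.exp ((((t 0 : ℤ) : ℂ) + ((t 1 : ℤ) : ℂ) * Complex.I) / ((t 2 : ℤ) : ℂ)) - 1)) ∘ fun w' s => w' (Sum.inl s)) w}) :=
    defC_congr (defC_sub defC_cexp_testPoint (defC_ratCast (σ := Fin 3) 1)) fun t => by simp
  refine defC_const_of_isolated_zero (f := fun z => Complex.exp z - 1) (Complex.continuous_exp.sub continuous_const) hdef
    (by simp [Complex.exp_two_pi_mul_I]) ⟨1, one_pos, fun z hz hd => ?_⟩
  obtain ⟨n, rfl⟩ := Complex.exp_eq_one_iff.1 (sub_eq_zero.1 hz)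
  by_contra hne
  have hn1 : n - 1 ≠ 0 := fun h => hne (by rw [sub_eq_zero.1 h]; simp)
  have := one_le_norm_int_mul_two_pi_I hn1
  rw [Complex.dist_eq] at hd
  have e : (n : ℂ) * (2 * ↑Real.pi * Complex.I) - 2 * ↑Real.pi * Complex.I = ((n - 1 : ℤ) : ℂ) * (2 * ↑Real.pi * Complex.I) := by
    push_cast; ring
  rw [e] at hd
  linarith

/-- **A logarithm of an algebraic number is a ring-definable complex constant**: if `e^u ∈ ℚ̄` then `u` is the isolated zero of
`exp − e^u` near itself. [folklore] -/
theorem defC_const_of_isAlgebraic_cexp {u : ℂ} (hu : IsAlgebraic ℚ (Complex.exp u)) : ((∅ : Set ℤ).Definable Language.ring {w : _ ⊕ Fin 2 → ℤ | 0 < w (Sum.inr 1) ∧ ((w (Sum.inr 0) : ℤ) : ℝ) < ((w (Sum.inr 1) : ℤ) : ℝ) * ((Complex.re ∘ (fun _ : σ → ℤ => u)) ∘ fun w' s => w' (Sum.inl s)) w} ∧ (∅ : Set ℤ).Definable Language.ring {w : _ ⊕ Fin 2 → ℤ | 0 < w (Sum.inr 1) ∧ ((w (Sum.inr 0) : ℤ)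 : ℝ) < ((w (Sum.inr 1) : ℤ) : ℝ) * ((Complex.im ∘ (fun _ : σ → ℤ => u)) ∘ fun w' s => w' (Sum.inl s)) w}) := by
  have hdef : ((∅ : Set ℤ).Definable Language.ring {w : _ ⊕ Fin 2 → ℤ | 0 < w (Sum.inr 1) ∧ ((w (Sum.inr 0) : ℤ) : ℝ) < ((w (Sum.inr 1) : ℤ) : ℝ) * ((Complex.re ∘ (fun t : Fin 3 → ℤ =>
      Complex.exp ((((t 0 : ℤ) : ℂ) + ((t 1 : ℤ) : ℂ) * Complex.I) / ((t 2 : ℤ) : ℂ)) - Complex.exp u)) ∘ fun w' s => w' (Sum.inl s)) w} ∧ (∅ : Set ℤ).Definable Language.ring {w : _ ⊕ Fin 2 → ℤ | 0 < w (Sum.inr 1) ∧ ((w (Sum.inr 0) : ℤ) : ℝ) < ((w (Sum.inr 1) : ℤ) : ℝ) * ((Complex.im ∘ (fun t : Fin 3 → ℤ =>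
      Complex.exp ((((t 0 : ℤ) : ℂ) + ((t 1 : ℤ) : ℂ) * Complex.I) / ((t 2 : ℤ) : ℂ)) - Complex.exp u)) ∘ fun w' s => w' (Sum.inl s)) w}) :=
    defC_sub defC_cexp_testPoint (defC_const_of_isAlgebraic hu)
  refine defC_const_of_isolated_zero (f := fun z => Complex.exp z - Complex.exp u)
    (Complex.continuous_exp.sub continuous_const) hdef (by simp) ⟨1, one_pos, fun z hz hd => ?_⟩
  obtain ⟨n, rfl⟩ := Complex.exp_eq_exp_iff_exists_int.1 (sub_eq_zero.1 hz)
  by_contra hne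
  have hn : n ≠ 0 := fun h => hne (by rw [h]; simp)
  have := one_le_norm_int_mul_two_pi_I hn
  rw [Complex.dist_eq, add_sub_cancel_left] at hd
  linarith

/-! ## Registered form -/

omit [FirstOrder.Ring.CompatibleRing ℤ] in
/-- Registered helper stub `ringDefinable_realCut_two_pi` of crux stmt-Schanuel-0969 (line kernel-arithmetic-selection, S8‴):
**`π` is an arithmetical real** — the strict lower rational cut `{(p, r) ∈ ℤ² : 0 < r ∧ p/r < 2π}` is `∅`-definable in the ring
`ℤ` (as the imaginary part of the isolated zero `2πi` of `exp − 1`, through the ring-definability of `exp` on `ℚ[i]`).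
[folklore] -/
theorem ringDefinable_realCut_two_pi : ∀ [FirstOrder.Ring.CompatibleRing ℤ], (∅ : Set ℤ).Definable FirstOrder.Language.ring {v : Fin 2 → ℤ | 0 < v 1 ∧ ((v 0 : ℤ) : ℝ) < ((v 1 : ℤ) : ℝ) * (2 * Real.pi)} := by
  intro _
  have h := Set.Definable.preimage_comp (Sum.elim Fin.elim0 id : Fin 0 ⊕ Fin 2 → Fin 2) (defC_const_twoPiI (σ := Fin 0)).2
  convert h using 1
  ext v
  simp

end Summit.Schanuel.Schanuel.Cruxes.MinimalCounterexampleInAcl.KernelArithmeticSelection
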